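/-
Copyright (c) 2026. All rights reserved.
Released under Apache 2.0 license as described in the file LICENSE.
Authors: abc-iut cell, IUT REPAIR / RESCUE-H prover seat abc-iut-rp-d4 (gen 4).
-/
import Literature.IUT.LogVolume.UnitLogIntoMaximalIdeal
import HarnessLib

/-!
# `k`-th roots of principal units for `p ∤ k` (Newton iteration in a complete ultrametric `ℚ_p`-algebra)

PROOF-ONLY file (no `def`, no named fact) of the abc-iut cell (D-0079 RESCUE-H «local-height condition I06⋆»;
seat abc-iut-rp-d4, the valuation-profile lineage `UnitLogValuationProfile{,Shell,NoZeta,BoundaryBall}`), supplying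
the classical root-extraction step used by `UnitLogValuationProfileCosets.lean` / `…Realisable.lean` to turn
elements of `log_p(𝒪_K^×)` into REALISING elements `p·q^{1−n}` of a prescribed norm.  Setting: `K` a nontrivially
normed field and normed `ℚ_p`-algebra, ultrametric; completeness where the limit is taken.

* §1 the binomial tail **`‖(1 + h)ᵏ − (1 + k·h)‖ ≤ ‖h‖²`** for `‖h‖ ≤ 1`
  (`norm_one_add_pow_sub_le`; induction on `k`, no binomial coefficients).
* §2 one NEWTON STEP for `vᵏ = u` (`p ∤ k`, so `‖k‖ = 1`): from `v` with `‖v‖ = 1` pass to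
  `v' = v·(1 + (u − vᵏ)/(k·vᵏ))`; then `‖v' − v‖ = ‖u − vᵏ‖` and `‖u − v'ᵏ‖ ≤ ‖u − vᵏ‖²` (`newton_step`).
* §3 **every principal unit is a `k`-th power of a principal unit when `p ∤ k`**: for `‖1 − u‖ < 1` there is
  `w` with `‖1 − w‖ ≤ ‖1 − u‖` and `wᵏ = u` (`exists_pow_eq_of_isPrincipal`; the iterates form a Cauchy sequence
  with geometric ratio `‖1 − u‖`); coset form `exists_eq_mul_pow_of_norm_sub_lt`: if `‖z − A‖ < ‖A‖` then
  `z = A·wᵏ` with `w` principal.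

Classical (Neukirch, *Algebraic Number Theory*, Ch. II (4.6) Hensel's lemma, (5.8); Koblitz GTM 58 Ch. I §5, IV §1);
nothing here is disputed mathematics; no IUT statement is asserted; nothing here bears on [IUTchIII] Cor. 3.12.
References: [cite: NeukirchANT1999, Ch. II (4.6), (5.8)] [cite: Koblitz1984, Ch. I §5].
-/

noncomputable section

open Metric Filter
open _root_.Topology IsUltrametricDist

namespace Literature.IUT.LogVolume

namespace PrincipalRoot

variable (p : ℕ) [hp : Fact p.Prime]
variable {K : Type*} [NontriviallyNormedField K] [instK : NormedAlgebra ℚ_[p] K] [IsUltrametricDist K]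

/-! ### §1. The binomial tail -/

include instK in
omit [IsUltrametricDist K] in
/-- Natural numbers have norm `≤ 1` in a normed `ℚ_p`-algebra (private copy of a tree lemma stated for other
carriers, e.g. `LinGroupK.norm_natCast_le_one'`). [cite: Koblitz1984, Ch. I §2] -/
private theorem norm_natCast_le_one (n : ℕ) : ‖(n : K)‖ ≤ 1 := by
  rw [norm_natCast_eq_padicNorm p K n]
  exact_mod_cast Padic.norm_int_le_one (p := p) (n : ℤ)

include instK in
/-- **Binomial tail**: `‖(1 + h)ᵏ − (1 + k·h)‖ ≤ ‖h‖²` for `‖h‖ ≤ 1` (induction on `k`: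
`T_{k+1} = (1 + h)·T_k + k·h²`, ultrametric inequality, `‖1 + h‖ ≤ 1`, `‖k‖ ≤ 1`). [cite: Koblitz1984, Ch. I §5] -/
theorem norm_one_add_pow_sub_le {h : K} (hh : ‖h‖ ≤ 1) (k : ℕ) :
    ‖(1 + h) ^ k - (1 + (k : K) * h)‖ ≤ ‖h‖ ^ 2 := by
  induction k with
  | zero =>
    simp only [pow_zero, Nat.cast_zero, zero_mul, add_zero, sub_self, norm_zero]
    positivity
  | succ k ih =>
    have hrec : (1 + h) ^ (k + 1) - (1 + ((k + 1 : ℕ) : K) * h)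
        = (1 + h) * ((1 + h) ^ k - (1 + (k : K) * h)) + (k : K) * h ^ 2 := by
      push_cast
      ring
    rw [hrec]
    have h1 : ‖(1 : K) + h‖ ≤ 1 := (norm_add_le_max _ _).trans (max_le (by rw [norm_one]) hh)
    refine (norm_add_le_max _ _).trans (max_le ?_ ?_)
    · rw [norm_mul]
      calc ‖1 + h‖ * ‖(1 + h) ^ k - (1 + (k : K) * h)‖ ≤ 1 * ‖h‖ ^ 2 :=
            mul_le_mul h1 ih (norm_nonneg _) zero_le_one
        _ = ‖h‖ ^ 2 := one_mul _
    · rw [norm_mul, norm_pow]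
      calc ‖(k : K)‖ * ‖h‖ ^ 2 ≤ 1 * ‖h‖ ^ 2 :=
            mul_le_mul_of_nonneg_right (norm_natCast_le_one p k) (pow_nonneg (norm_nonneg _) _)
        _ = ‖h‖ ^ 2 := one_mul _

/-! ### §2. One Newton step for `vᵏ = u`, `p ∤ k` -/

include instK in
/-- **Newton step.**  `p ∤ k`, `‖v‖ = 1`, `‖u − vᵏ‖ ≤ 1`, `v' := v·(1 + (u − vᵏ)/(k·vᵏ))`: then
`‖v' − v‖ = ‖u − vᵏ‖` and `‖u − v'ᵏ‖ ≤ ‖u − vᵏ‖²` (with `η := (u − vᵏ)/(k vᵏ)`, `‖η‖ = ‖u − vᵏ‖` as `‖k‖ = 1`, and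
`v'ᵏ = vᵏ(1 + η)ᵏ = vᵏ + (u − vᵏ) + vᵏ·[(1 + η)ᵏ − (1 + kη)]`). [cite: NeukirchANT1999, Ch. II (4.6)] -/
theorem newton_step {k : ℕ} (hpk : ¬ p ∣ k) {u v : K} (hv : ‖v‖ = 1) (hr : ‖u - v ^ k‖ ≤ 1) :
    ‖v * (1 + (u - v ^ k) / ((k : K) * v ^ k)) - v‖ = ‖u - v ^ k‖ ∧
      ‖u - (v * (1 + (u - v ^ k) / ((k : K) * v ^ k))) ^ k‖ ≤ ‖u - v ^ k‖ ^ 2 := by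
  have hk1 : ‖(k : K)‖ = 1 := norm_natCast_eq_one_of_not_dvd p hpk
  have hk0 : (k : K) ≠ 0 := norm_pos_iff.mp (by rw [hk1]; exact one_pos)
  have hv0 : v ≠ 0 := norm_pos_iff.mp (by rw [hv]; exact one_pos)
  have hvk0 : v ^ k ≠ 0 := pow_ne_zero k hv0
  set r : K := u - v ^ k with hr_def
  set η : K := r / ((k : K) * v ^ k) with hη
  have hηn : ‖η‖ = ‖r‖ := by
    rw [hη, norm_div, norm_mul, hk1, norm_pow, hv, one_pow, one_mul, div_one]
  refine ⟨?_, ?_⟩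
  · rw [show v * (1 + η) - v = v * η by ring, norm_mul, hv, one_mul, hηn]
  · have hη1 : ‖η‖ ≤ 1 := by rw [hηn]; exact hr
    have hT := norm_one_add_pow_sub_le p hη1 k
    have hkey : (k : K) * v ^ k * η = r := by
      rw [hη]
      field_simp
    have hu : u = v ^ k + r := by rw [hr_def]; ring
    have hexp : u - (v * (1 + η)) ^ k = -(v ^ k * ((1 + η) ^ k - (1 + (k : K) * η))) := by
      rw [mul_pow]
      linear_combination hu - hkey
    rw [hexp, norm_neg, norm_mul, norm_pow, hv, one_pow, one_mul, ← hηn]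
    exact hT

/-! ### §3. Every principal unit is a `k`-th power (`p ∤ k`) -/

include instK in
/-- **`k`-th roots of principal units, `p ∤ k`.**  If `‖1 − u‖ < 1` then `u = wᵏ` for some `w` with
`‖1 − w‖ ≤ ‖1 − u‖` (Newton iteration from `w₀ = 1`: residuals `‖u − wᵢᵏ‖ ≤ ‖1 − u‖^{i+1}`, steps
`‖wᵢ₊₁ − wᵢ‖ ≤ ‖1 − u‖^{i+1}`; Cauchy in the complete `K`; the limit is a root by continuity of `x ↦ xᵏ`).
Equivalently `(1 + 𝔪_K)ᵏ = 1 + 𝔪_K` level by level.  [cite: NeukirchANT1999, Ch. II (4.6), (5.8)] -/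
theorem exists_pow_eq_of_isPrincipal [CompleteSpace K] {k : ℕ} (hpk : ¬ p ∣ k) {u : K}
    (hu : IsPrincipal u) : ∃ w : K, ‖1 - w‖ ≤ ‖1 - u‖ ∧ w ^ k = u := by
  set ρ : ℝ := ‖1 - u‖ with hρdef
  have hρ0 : 0 ≤ ρ := norm_nonneg _
  have hρ1 : ρ < 1 := hu
  -- the Newton iteration
  let v : ℕ → K := fun i ↦ Nat.rec (1 : K) (fun _ w ↦ w * (1 + (u - w ^ k) / ((k : K) * w ^ k))) i
  have hv0 : v 0 = 1 := rfl
  have hvsucc : ∀ i, v (i + 1) = v i * (1 + (u - v i ^ k) / ((k : K) * v i ^ k)) := fun _ ↦ rfl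
  have hρi : ∀ i : ℕ, ρ ^ (i + 1) ≤ ρ := fun i ↦
    calc ρ ^ (i + 1) ≤ ρ ^ 1 := pow_le_pow_of_le_one hρ0 hρ1.le (by omega)
      _ = ρ := pow_one ρ
  -- joint invariant
  have inv : ∀ i : ℕ, ‖1 - v i‖ ≤ ρ ∧ ‖u - v i ^ k‖ ≤ ρ ^ (i + 1) := by
    intro i
    induction i with
    | zero =>
      refine ⟨by rw [hv0, sub_self, norm_zero]; exact hρ0, ?_⟩
      rw [hv0, one_pow, zero_add, pow_one, hρdef, norm_sub_rev]
    | succ i ih =>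
      obtain ⟨h1, h2⟩ := ih
      have hr1 : ‖u - v i ^ k‖ ≤ 1 := (h2.trans (hρi i)).trans hρ1.le
      have hvi : ‖v i‖ = 1 := IsPrincipal.norm_eq_one (h1.trans_lt hρ1)
      obtain ⟨hstep1, hstep2⟩ := newton_step p hpk hvi hr1
      refine ⟨?_, ?_⟩
      · have hsplit : (1 : K) - v (i + 1) = (1 - v i) + -(v (i + 1) - v i) := by ring
        rw [hsplit]
        refine (norm_add_le_max _ _).trans (max_le h1 ?_)
        rw [norm_neg, hvsucc, hstep1]
        exact h2.trans (hρi i)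
      · rw [hvsucc]
        calc ‖u - (v i * (1 + (u - v i ^ k) / ((k : K) * v i ^ k))) ^ k‖ ≤ ‖u - v i ^ k‖ ^ 2 := hstep2
          _ ≤ ρ ^ (i + 1) * ρ ^ (i + 1) := by
              rw [sq]; exact mul_le_mul h2 h2 (norm_nonneg _) (pow_nonneg hρ0 _)
          _ ≤ ρ ^ (i + 1) * ρ := mul_le_mul_of_nonneg_left (hρi i) (pow_nonneg hρ0 _)
          _ = ρ ^ (i + 1 + 1) := by ring
  -- Cauchy
  have hdist : ∀ i, dist (v i) (v (i + 1)) ≤ ρ * ρ ^ i := by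
    intro i
    obtain ⟨h1, h2⟩ := inv i
    have hr1 : ‖u - v i ^ k‖ ≤ 1 := (h2.trans (hρi i)).trans hρ1.le
    have hvi : ‖v i‖ = 1 := IsPrincipal.norm_eq_one (h1.trans_lt hρ1)
    rw [dist_eq_norm, norm_sub_rev, hvsucc, (newton_step p hpk hvi hr1).1]
    calc ‖u - v i ^ k‖ ≤ ρ ^ (i + 1) := h2
      _ = ρ * ρ ^ i := by ring
  have hcauchy : CauchySeq v := cauchySeq_of_le_geometric ρ ρ hρ1 hdist
  obtain ⟨w, hw⟩ := cauchySeq_tendsto_of_complete hcauchy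
  refine ⟨w, ?_, ?_⟩
  · have ht : Tendsto (fun i ↦ ‖1 - v i‖) atTop (𝓝 ‖1 - w‖) :=
      ((continuous_const.sub continuous_id).norm.tendsto w).comp hw
    exact le_of_tendsto' ht fun i ↦ (inv i).1
  · have h1 : Tendsto (fun i ↦ v i ^ k) atTop (𝓝 (w ^ k)) := ((continuous_pow k).tendsto w).comp hw
    have h2 : Tendsto (fun i ↦ v i ^ k) atTop (𝓝 u) := by
      rw [tendsto_iff_norm_sub_tendsto_zero]
      have hg : Tendsto (fun i : ℕ ↦ ρ ^ (i + 1)) atTop (𝓝 0) :=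
        (tendsto_pow_atTop_nhds_zero_of_lt_one hρ0 hρ1).comp (tendsto_add_atTop_nat 1)
      refine squeeze_zero (fun i ↦ norm_nonneg _) (fun i ↦ ?_) hg
      rw [norm_sub_rev]
      exact (inv i).2
    exact tendsto_nhds_unique h1 h2

include instK in
/-- `k`-th roots of principal units, `p ∤ k`, principal-unit form: `u = wᵏ` with `w` principal.
[cite: NeukirchANT1999, Ch. II (5.8)] -/
theorem exists_isPrincipal_pow_eq [CompleteSpace K] {k : ℕ} (hpk : ¬ p ∣ k) {u : K}
    (hu : IsPrincipal u) : ∃ w : K, IsPrincipal w ∧ w ^ k = u := by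
  obtain ⟨w, hw, hwk⟩ := exists_pow_eq_of_isPrincipal p hpk hu
  exact ⟨w, hw.trans_lt hu, hwk⟩

include instK in
/-- **Coset form.**  If `‖z − A‖ < ‖A‖` (i.e. `z/A` is a principal unit) and `p ∤ k`, then `z = A·wᵏ` for a
principal unit `w`. [cite: NeukirchANT1999, Ch. II (5.8)] -/
theorem exists_eq_mul_pow_of_norm_sub_lt [CompleteSpace K] {k : ℕ} (hpk : ¬ p ∣ k) {A z : K}
    (hz : ‖z - A‖ < ‖A‖) : ∃ w : K, IsPrincipal w ∧ z = A * w ^ k := by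
  have hA0 : A ≠ 0 := by
    intro h
    rw [h, sub_zero, norm_zero] at hz
    exact (norm_nonneg z).not_gt hz
  have hA : 0 < ‖A‖ := norm_pos_iff.mpr hA0
  have hu : IsPrincipal (z / A) := by
    change ‖1 - z / A‖ < 1
    rw [show (1 : K) - z / A = (A - z) / A by field_simp, norm_div, norm_sub_rev, div_lt_one hA]
    exact hz
  obtain ⟨w, hw, hwk⟩ := exists_isPrincipal_pow_eq p hpk hu
  exact ⟨w, hw, by rw [hwk, mul_div_cancel₀ z hA0]⟩

end PrincipalRoot

end Literature.IUT.LogVolume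

end
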